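import Summits.BirchSwinnertonDyer.BirchSwinnertonDyer.Theorems.PrintCf2RubinValueTwoKatzMeasureJZeroUnique
import Summits.BirchSwinnertonDyer.BirchSwinnertonDyer.Theorems.PrintCf2RubinValueTwoKatzJZeroUniqueChar
import HarnessLib

/-!
# Uniqueness of the `j = 0` Katz–de Shalit measure on `Γ_K`, III: the auxiliary modulus and the characters
# `ψ_j` from ONE character of type `(−1, 0)` unramified off `v̄` (de Shalit 1987, II.1.9, II.4.12)

Cell `bsd-print-cf2`, width seat `bsd-line-cf2-p1-w5` g15; sequel of `…KatzMeasureJZeroUnique.lean` (II).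
Its uniqueness theorem takes an auxiliary modulus `𝔪₀` (`v ∤ 𝔪₀`, `w_{𝔪₀} = 1`, supported on `S ∪ {v̄}`) and,
for every `j ≥ m₀`, a character `ψ_j` of type `(−j, 0)` with module of definition `≤ 𝔪₀` unramified outside
`S ∪ {v̄}`. THIS file supplies both from ONE Hecke character `φ₀` of type `(−1, 0)` unramified at every `w ≠ v̄`
(e.g., over `ℚ(√−7)` at `p = 2`, the inverse of the "primary generator" character of conductor `v̄²`):
`IsModulus` and unramifiedness are stable under powers, the type of `φ₀^j` is `(−j, 0)`, a module of definition
of `φ₀` lives on its ramified places `⊆ {v̄}` (`exists_isModulus_of_ramified`), and `𝔪₀ := v̄^{max(e,2)}` has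
`w_{𝔪₀} = 1` as soon as no unit `≠ 1` is `≡ 1 (mod v̄²)` (`#𝓞_K^× = 2`, `2 = v v̄`). Whence ★★★
`μ_eq_of_forall_identity_of_char` / `μ_eq_of_forall_integral_avatar_eq_of_char`: the uniqueness theorem with
`(𝔪₀, ψ_j)` replaced by `φ₀`. Theorems only; no `sorry`; nothing is closed; BSD is not proved by any of this.

## References

* [deShalit1987] E. de Shalit, *Iwasawa theory of elliptic curves with complex multiplication* (1987), II.1.9
  (p. 43), II.4.12 Remark (iv) (p. 67), II Thm. 4.14 (p. 71); [NeukirchANT1999] Ch. VII §6 (6.11); [Weil1956] §1.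
-/

noncomputable section

namespace Summit.BirchSwinnertonDyer.BirchSwinnertonDyer.Theorems.PrintCf2.KatzJZeroUnique

open scoped NumberField Topology Classical nonZeroDivisors
open NumberField IsDedekindDomain IsDedekindDomain.HeightOneSpectrum Field Filter Polynomial
open Literature.NumberTheory.EllipticCurves Literature.NumberTheory.GaloisRepresentations
open Literature.NumberTheory.NumberFields

set_option linter.dupNamespace false -- D-0017: single-problem summit, `…BirchSwinnertonDyer.BirchSwinnertonDyer…` repeats a namespace by design
set_option autoImplicit false

variable {p : ℕ} [hp : Fact p.Prime] {K : Type} [Field K] [NumberField K]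

/-! ### §1. The auxiliary data from ONE character of type `(−1, 0)` unramified off `v̄` -/

section Supply



/-- `IsModulus` is preserved by products (both factors kill the test idèles).
[cite: NeukirchANT1999, Ch. VII §6 (6.11)] -/
theorem isModulus_mul {χ ψ : HeckeCharacter K} {T : Finset (HeightOneSpectrum (𝓞 K))}
    {em : HeightOneSpectrum (𝓞 K) → ℕ} (hχ : χ.IsModulus T em) (hψ : ψ.IsModulus T em) :
    (χ * ψ).IsModulus T em := fun x h1 h2 h3 ↦ by
  rw [HeckeCharacter.mul_apply, hχ x h1 h2 h3, hψ x h1 h2 h3, one_mul]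

/-- `IsModulus` for the powers of a character. [cite: NeukirchANT1999, Ch. VII §6 (6.11)] -/
theorem isModulus_pow {χ : HeckeCharacter K} {T : Finset (HeightOneSpectrum (𝓞 K))}
    {em : HeightOneSpectrum (𝓞 K) → ℕ} (hχ : χ.IsModulus T em) (j : ℕ) : (χ ^ j).IsModulus T em := by
  induction j with
  | zero => intro x _ _ _; rw [pow_zero, HeckeCharacter.one_apply]
  | succ j ih => rw [pow_succ]; exact isModulus_mul ih hχ

/-- The `j`-th power of a character of type `(−1, 0)` has type `(−j, 0)`. [cite: Weil1956, §1] -/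
theorem hasInfinityType_pow_of_neg_one {χ : HeckeCharacter K} (hχ : χ.HasInfinityType (fun _ ↦ -1) (fun _ ↦ 0))
    (j : ℕ) : (χ ^ j).HasInfinityType (fun _ ↦ -(j : ℤ)) (fun _ ↦ ((0 : ℕ) : ℤ)) := by
  induction j with
  | zero =>
    have h := HeckeCharacter.IsFiniteOrder.hasInfinityType_zero
      (show (χ ^ 0).IsFiniteOrder by
        rw [pow_zero]; exact isOfFinOrder_iff_pow_eq_one.mpr ⟨1, one_pos, one_pow 1⟩)
    have e1 : (fun _ ↦ -((0 : ℕ) : ℤ) : InfinitePlace K → ℤ) = fun _ ↦ 0 := by funext w; simp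
    have e2 : (fun _ ↦ ((0 : ℕ) : ℤ) : InfinitePlace K → ℤ) = fun _ ↦ 0 := by funext w; simp
    rw [e1, e2]
    exact h
  | succ j ih =>
    have h := ih.mul' hχ
    have e1 : ((fun _ ↦ -(j : ℤ)) + fun _ ↦ (-1 : ℤ) : InfinitePlace K → ℤ) = fun _ ↦ -((j + 1 : ℕ) : ℤ) := by
      funext w; simp only [Pi.add_apply]; push_cast; ring
    have e2 : ((fun _ ↦ ((0 : ℕ) : ℤ)) + fun _ ↦ (0 : ℤ) : InfinitePlace K → ℤ) = fun _ ↦ ((0 : ℕ) : ℤ) := by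
      funext w; simp only [Pi.add_apply]; simp
    rw [pow_succ, ← e1, ← e2]
    exact h

variable {v vbar : HeightOneSpectrum (𝓞 K)} {S : Finset (HeightOneSpectrum (𝓞 K))}

/-- ★ **The auxiliary modulus and characters from ONE `φ₀` of type `(−1, 0)` unramified off `v̄`**: with
`(T, e)` a module of definition of `φ₀` on its ramified places (`exists_isModulus_of_ramified`, `T ⊆ {v̄}`),
`𝔪₀ := v̄^{max(e_{v̄}, 2)}` is non-zero, prime to `v ≠ v̄`, supported on `{v̄}`, has `w_{𝔪₀} = 1` as soon as no
unit `≠ 1` is `≡ 1 (mod v̄²)`, and the powers `φ₀^j` supply the characters `ψ_j` of type `(−j, 0)` with module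
of definition `≤ 𝔪₀`, unramified outside `S ∪ {v̄}`. [cite: deShalit1987, II.1.9 (p. 43), II.4.12 (p. 66)]
[cite: NeukirchANT1999, Ch. VII §6 (6.11)] -/
theorem exists_aux_of_char (hne : vbar ≠ v) (hw2 : ∀ u : (𝓞 K)ˣ, (u : 𝓞 K) - 1 ∈ vbar.asIdeal ^ 2 → u = 1)
    {φ₀ : HeckeCharacter K} (hφ₀ : φ₀.HasInfinityType (fun _ ↦ -1) (fun _ ↦ 0))
    (hφ₀unr : ∀ w : HeightOneSpectrum (𝓞 K), w ≠ vbar → φ₀.IsUnramifiedAt w) (m₀ : ℕ) :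
    ∃ 𝔪₀ : Ideal (𝓞 K), 𝔪₀ ≠ ⊥ ∧ ¬ 𝔪₀ ≤ v.asIdeal ∧ (∀ u : (𝓞 K)ˣ, (u : 𝓞 K) - 1 ∈ 𝔪₀ → u = 1) ∧
      (∀ w : HeightOneSpectrum (𝓞 K), 𝔪₀ ≤ w.asIdeal → w ∈ S ∨ w = vbar) ∧
      ∀ j : ℕ, m₀ ≤ j → ∃ (ψ : HeckeCharacter K) (T : Finset (HeightOneSpectrum (𝓞 K)))
          (em : HeightOneSpectrum (𝓞 K) → ℕ),
        ψ.HasInfinityType (fun _ ↦ -(j : ℤ)) (fun _ ↦ ((0 : ℕ) : ℤ)) ∧ ψ.IsModulus T em ∧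
        (∀ w ∈ T, (em w : ℤ) ≤ FractionalIdeal.count K w (𝔪₀ : FractionalIdeal (𝓞 K)⁰ K)) ∧
        (∀ w : HeightOneSpectrum (𝓞 K), w ∉ S → w ≠ vbar → ψ.IsUnramifiedAt w) := by
  classical
  obtain ⟨em, hmod⟩ := φ₀.exists_isModulus_of_ramified
  set T := (HeckeCharacter.finite_ramifiedPlaces_holds φ₀).toFinset with hT
  have hTsub : ∀ w ∈ T, w = vbar := by
    intro w hw
    rw [hT, Set.Finite.mem_toFinset] at hw
    by_contra h
    exact hw (hφ₀unr w h)
  set k : ℕ := max (em vbar) 2 with hk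
  refine ⟨vbar.asIdeal ^ k, pow_ne_zero _ vbar.ne_bot, fun h ↦ ?_, fun u hu ↦ ?_, fun w hw ↦ ?_, fun j _ ↦ ?_⟩
  · exact hne (HeightOneSpectrum.ext (vbar.isMaximal.eq_of_le v.isPrime.ne_top (v.isPrime.le_of_pow_le h)))
  · exact hw2 u (Ideal.pow_le_pow_right (le_max_right _ _) hu)
  · exact Or.inr (HeightOneSpectrum.ext (vbar.isMaximal.eq_of_le w.isPrime.ne_top (w.isPrime.le_of_pow_le hw))).symm
  · refine ⟨φ₀ ^ j, T, em, hasInfinityType_pow_of_neg_one hφ₀ j, isModulus_pow hmod j, fun w hw ↦ ?_,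
      fun w _ hwv ↦ by simpa only [zpow_natCast] using (hφ₀unr w hwv).zpow' (j : ℤ)⟩
    rw [hTsub w hw, FractionalIdeal.coeIdeal_pow, FractionalIdeal.count_pow, FractionalIdeal.count_self]
    simp only [mul_one, hk]
    exact_mod_cast le_max_left _ _

end Supply
/-! ### §2. The uniqueness theorem with `(𝔪₀, ψ_j)` supplied from `φ₀` -/

section OfChar

variable [IsTotallyComplex K] (ι : PadicAlgCl p ≃+* ℂ) {v vbar : HeightOneSpectrum (𝓞 K)}
  {S : Finset (HeightOneSpectrum (𝓞 K))}
  (hvbar : ((p : ℕ) : 𝓞 K) ∈ vbar.asIdeal) (hvS : v ∉ S) (hne : vbar ≠ v)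
  (hp2 : v.asIdeal * vbar.asIdeal ≤ Ideal.span {((p : ℕ) : 𝓞 K)})
  [v.asIdeal.LiesOver (ratPlace p).asIdeal]
  (he : v.asIdeal.ramificationIdx (𝓞 ℚ) = 1) (hf : v.asIdeal.inertiaDeg (𝓞 ℚ) = 1)
  (hvp : ((p : ℕ) : 𝓞 K) ∈ v.asIdeal) {w₀ : InfinitePlace K} (hw₀ : ∀ w : InfinitePlace K, w = w₀)
  (hιv : ∀ d : 𝓞 K, d ∈ v.asIdeal ↔ ‖ι.symm (w₀.embedding (d : K))‖ < 1)
  (hw2 : ∀ u : (𝓞 K)ˣ, (u : 𝓞 K) - 1 ∈ vbar.asIdeal ^ 2 → u = 1)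
  {φ₀ : HeckeCharacter K} (hφ₀ : φ₀.HasInfinityType (fun _ ↦ -1) (fun _ ↦ 0))
  (hφ₀unr : ∀ w : HeightOneSpectrum (𝓞 K), w ≠ vbar → φ₀.IsUnramifiedAt w)
  {𝒰 : SubgroupTower (absoluteGaloisGroup K)} (hopen : ∀ n, IsOpen (𝒰.U n : Set (absoluteGaloisGroup K)))
  (hray : ⋂ n, (𝒰.U n : Set (absoluteGaloisGroup K)) ⊆ DeShalit1987.rayKer K p S)
  (hray' : ∀ n, DeShalit1987.rayKer K p S ≤ 𝒰.U n) {m₀ : ℕ}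

include hvbar hvS hne hp2 he hf hvp hw₀ hιv hw2 hφ₀ hφ₀unr hopen hray hray' in
/-- ★★★ **UNIQUENESS OF THE `j = 0` MEASURE ON `Γ_K`, `φ₀`-form**: `K` with one infinite place and trivial units
mod `v̄²`, `v` of degree one = the place of `ι⁻¹∘σ_{w₀}`, `v ∉ S`, `v̄ ≠ v`, `v·v̄ ⊆ (p)`, ONE Hecke character `φ₀` of
type `(−1,0)` unramified off `v̄`, a tower of open subgroups with `⋂ U_n ⊆ rayKer K p S ≤ U_n`: two bounded
distributions whose integrals of every in-range avatar (type `(−m,0)`, `m ≥ m₀`, unramified outside `S ∪ {v̄}`,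
avatar outside `S`, tower-continuous) agree are equal on every cell. [cite: deShalit1987, II Thm. 4.14 (p. 71), II.4.12 Remark (iv) (p. 67)] -/
theorem μ_eq_of_forall_integral_avatar_eq_of_char (μ μ' : GroupDistribution 𝒰 ℂ_[p])
    (hint : ∀ (ε : HeckeCharacter K) (e : FramedGaloisRep K (PadicAlgCl p) 1) (m : ℕ),
      IsPAdicAvatarOutside S ι ε e → m₀ ≤ m →
      ε.HasInfinityType (fun _ ↦ -(m : ℤ)) (fun _ ↦ ((0 : ℕ) : ℤ)) →
      (∀ w : HeightOneSpectrum (𝓞 K), w ∉ S → w ≠ vbar → ε.IsUnramifiedAt w) →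
      𝒰.IsTowerContinuous (fun σ ↦ avatarValueAt e σ) →
      μ.integral (fun σ ↦ avatarValueAt e σ) = μ'.integral (fun σ ↦ avatarValueAt e σ))
    (N : ℕ) (a : absoluteGaloisGroup K ⧸ 𝒰.U N) : μ.μ N a = μ'.μ N a := by
  obtain ⟨𝔪₀, h𝔪₀, hv𝔪₀, hw𝔪₀, hsupp, hψ⟩ := exists_aux_of_char (S := S) hne hw2 hφ₀ hφ₀unr m₀
  exact μ_eq_of_forall_integral_avatar_eq ι hvbar hvS hne hp2 he hf hvp hw₀ hιv h𝔪₀ hv𝔪₀ hw𝔪₀ hsupp hψ hopen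
    hray hray' μ μ' hint N a

include hvbar hvS hne hp2 he hf hvp hw₀ hιv hw2 hφ₀ hφ₀unr hopen hray hray' in
/-- ★★★ **The `(m,0)`-identities form** (`m₀ ≥ 1`, ANY right-hand side `R ε m hL`, e.g. the R3 endpoint's
`ι⁻¹(interpolationValue p v v̄ S ε m 0 Ω δ (hL.continuation 0))·Ω_p^m`): two bounded distributions along `𝒰`
satisfying the same identities are equal on every cell. [cite: deShalit1987, II Thm. 4.14 (p. 71), II.4.12 Remark (iv) (p. 67)] -/
theorem μ_eq_of_forall_identity_of_char (hm₀ : 1 ≤ m₀) (μ μ' : GroupDistribution 𝒰 ℂ_[p])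
    (R : (ε : HeckeCharacter K) → ℕ → LFunction.HasEntireContinuation (heckeLFunction ε) → ℂ_[p])
    (hμ : ∀ (ε : HeckeCharacter K) (e : FramedGaloisRep K (PadicAlgCl p) 1) (m : ℕ),
      IsPAdicAvatarOutside S ι ε e → m₀ ≤ m →
      ε.HasInfinityType (fun _ ↦ -(m : ℤ)) (fun _ ↦ ((0 : ℕ) : ℤ)) →
      (∀ w : HeightOneSpectrum (𝓞 K), w ∉ S → w ≠ vbar → ε.IsUnramifiedAt w) →
      𝒰.IsTowerContinuous (fun σ ↦ avatarValueAt e σ) →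
      ∀ hL : LFunction.HasEntireContinuation (heckeLFunction ε),
        μ.integral (fun σ ↦ avatarValueAt e σ) = R ε m hL)
    (hμ' : ∀ (ε : HeckeCharacter K) (e : FramedGaloisRep K (PadicAlgCl p) 1) (m : ℕ),
      IsPAdicAvatarOutside S ι ε e → m₀ ≤ m →
      ε.HasInfinityType (fun _ ↦ -(m : ℤ)) (fun _ ↦ ((0 : ℕ) : ℤ)) →
      (∀ w : HeightOneSpectrum (𝓞 K), w ∉ S → w ≠ vbar → ε.IsUnramifiedAt w) →
      𝒰.IsTowerContinuous (fun σ ↦ avatarValueAt e σ) →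
      ∀ hL : LFunction.HasEntireContinuation (heckeLFunction ε),
        μ'.integral (fun σ ↦ avatarValueAt e σ) = R ε m hL)
    (N : ℕ) (a : absoluteGaloisGroup K ⧸ 𝒰.U N) : μ.μ N a = μ'.μ N a := by
  obtain ⟨𝔪₀, h𝔪₀, hv𝔪₀, hw𝔪₀, hsupp, hψ⟩ := exists_aux_of_char (S := S) hne hw2 hφ₀ hφ₀unr m₀
  exact μ_eq_of_forall_identity ι hvbar hvS hne hp2 he hf hvp hw₀ hιv h𝔪₀ hv𝔪₀ hw𝔪₀ hsupp hψ hopen hray hray'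
    hm₀ μ μ' R hμ hμ' N a

end OfChar

/-! ### §3. The lane's setting: `𝓞_K` principal, `𝒪_{v̄} ≅ ℤ₂`, one infinite place — no auxiliary data at all -/

section Lane

variable [IsTotallyComplex K] [IsPrincipalIdealRing (𝓞 K)] (ι : PadicAlgCl 2 ≃+* ℂ)
  {v vbar : HeightOneSpectrum (𝓞 K)} {S : Finset (HeightOneSpectrum (𝓞 K))}
  (evbar : vbar.adicCompletionIntegers K ≃+* ℤ_[2])
  (hvbar : ((2 : ℕ) : 𝓞 K) ∈ vbar.asIdeal) (hvS : v ∉ S) (hne : vbar ≠ v)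
  (hp2 : v.asIdeal * vbar.asIdeal ≤ Ideal.span {((2 : ℕ) : 𝓞 K)})
  [v.asIdeal.LiesOver (ratPlace 2).asIdeal]
  (he : v.asIdeal.ramificationIdx (𝓞 ℚ) = 1) (hf : v.asIdeal.inertiaDeg (𝓞 ℚ) = 1)
  (hvp : ((2 : ℕ) : 𝓞 K) ∈ v.asIdeal) {w₀ : InfinitePlace K} (hw₀ : ∀ w : InfinitePlace K, w = w₀)
  (hιv : ∀ d : 𝓞 K, d ∈ v.asIdeal ↔ ‖ι.symm (w₀.embedding (d : K))‖ < 1)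
  {𝒰 : SubgroupTower (absoluteGaloisGroup K)} (hopen : ∀ n, IsOpen (𝒰.U n : Set (absoluteGaloisGroup K)))
  (hray : ⋂ n, (𝒰.U n : Set (absoluteGaloisGroup K)) ⊆ DeShalit1987.rayKer K 2 S)
  (hray' : ∀ n, DeShalit1987.rayKer K 2 S ≤ 𝒰.U n) {m₀ : ℕ}

include evbar hvbar hvS hne hp2 he hf hvp hw₀ hιv hopen hray hray' in
/-- ★★★ **UNIQUENESS OF THE `j = 0` MEASURE IN THE LANE'S SETTING (`p = 2`)**: `K` totally complex with one
infinite place, `𝓞_K` principal (so `K = ℚ(√−7)` when `2` splits), `2 ∈ v, v̄`, `v̄ ≠ v`,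
`v·v̄ ⊆ (2)`, `𝒪_{v̄} ≅ ℤ₂` (so every unit `≡ 1 (mod v̄²)` is `1`), `v` of degree one = the place of `ι⁻¹∘σ_{w₀}`, `v ∉ S`; a tower of open
subgroups with `⋂ U_n ⊆ rayKer K 2 S ≤ U_n`; `m₀ ≥ 1`. Two bounded distributions along `𝒰` satisfying the SAME
`(m,0)`-identities `∀ hL, ∫ ê dμ = R ε m hL` (all in-range `ε` of type `(−m,0)`, `m ≥ m₀`, unramified outside
`S ∪ {v̄}`, avatar outside `S`, tower-continuous) are EQUAL on every cell — planner (T4) clause 1 for the R3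
endpoint `lMeasureJZero_classNumberOne_two`, no auxiliary data left. [cite: deShalit1987, II Thm. 4.14 (p. 71), II.4.12 Remark (iv) (p. 67)] -/
theorem μ_eq_of_forall_identity_lane (hm₀ : 1 ≤ m₀) (μ μ' : GroupDistribution 𝒰 ℂ_[2])
    (R : (ε : HeckeCharacter K) → ℕ → LFunction.HasEntireContinuation (heckeLFunction ε) → ℂ_[2])
    (hμ : ∀ (ε : HeckeCharacter K) (e : FramedGaloisRep K (PadicAlgCl 2) 1) (m : ℕ),
      IsPAdicAvatarOutside S ι ε e → m₀ ≤ m →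
      ε.HasInfinityType (fun _ ↦ -(m : ℤ)) (fun _ ↦ ((0 : ℕ) : ℤ)) →
      (∀ w : HeightOneSpectrum (𝓞 K), w ∉ S → w ≠ vbar → ε.IsUnramifiedAt w) →
      𝒰.IsTowerContinuous (fun σ ↦ avatarValueAt e σ) →
      ∀ hL : LFunction.HasEntireContinuation (heckeLFunction ε),
        μ.integral (fun σ ↦ avatarValueAt e σ) = R ε m hL)
    (hμ' : ∀ (ε : HeckeCharacter K) (e : FramedGaloisRep K (PadicAlgCl 2) 1) (m : ℕ),
      IsPAdicAvatarOutside S ι ε e → m₀ ≤ m →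
      ε.HasInfinityType (fun _ ↦ -(m : ℤ)) (fun _ ↦ ((0 : ℕ) : ℤ)) →
      (∀ w : HeightOneSpectrum (𝓞 K), w ∉ S → w ≠ vbar → ε.IsUnramifiedAt w) →
      𝒰.IsTowerContinuous (fun σ ↦ avatarValueAt e σ) →
      ∀ hL : LFunction.HasEntireContinuation (heckeLFunction ε),
        μ'.integral (fun σ ↦ avatarValueAt e σ) = R ε m hL)
    (N : ℕ) (a : absoluteGaloisGroup K ⧸ 𝒰.U N) : μ.μ N a = μ'.μ N a := by
  obtain ⟨φ₀, hφ₀, hφ₀unr⟩ := exists_char_type_neg_one evbar hw₀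
  have hw2 : ∀ u : (𝓞 K)ˣ, (u : 𝓞 K) - 1 ∈ vbar.asIdeal ^ 2 → u = 1 :=
    units_eq_one_of_sub_one_mem_sq evbar hw₀
  exact μ_eq_of_forall_identity_of_char ι hvbar hvS hne hp2 he hf hvp hw₀ hιv hw2 hφ₀ hφ₀unr hopen hray hray'
    hm₀ μ μ' R hμ hμ' N a

end Lane

/-! ### §4. The endpoint's binders: `K` imaginary quadratic of class number one, `2 ∈ v, v̄`, `v̄ ≠ v` -/

section ImaginaryQuadratic

/-- ★★★ **UNIQUENESS OF THE `j = 0` MEASURE UNDER THE ENDPOINT'S BINDERS (`p = 2`)**: for `K` imaginary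
quadratic with `h_K = 1`, `2 ∈ v`, `2 ∈ v̄`, `v̄ ≠ v` (so `(2) = v·v̄` splits and `𝒪_v ≅ 𝒪_{v̄} ≅ ℤ₂`), `v` the
place of `ι⁻¹ ∘ σ_w` for every infinite place `w` — VERBATIM the binders of the R3 endpoint
`lMeasureJZero_classNumberOne_two` (= the hypothesis of
`DeShalit1987.katzDistributions₂₀_of_inlineLMeasures₀_classNumberOne` at `p := 2`) — any tame `S ∌ v`, and
a tower of open subgroups with `⋂ U_n ⊆ rayKer K 2 S ≤ U_n`: two bounded distributions along `𝒰` with the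
SAME `(m,0)`-identities `∀ hL, ∫ ê dμ = R ε m hL` (`m ≥ m₀ ≥ 1`; e.g. `m₀ = 3` and `R` the interpolation
formula of `IsLMeasure₀`) are EQUAL on every cell. Every degree-one / unit / principal-ideal side condition of
`μ_eq_of_forall_identity_lane` is discharged here (`padicIntEquivOfSplit`,
`ramificationIdx_eq_one_and_inertiaDeg_eq_one_of_natCast_mem_of_ne`, `span_natCast_eq_mul_of_finrank_eq_two`,
Mathlib `IsTotallyComplex.finrank` / `classNumber_eq_one_iff`).
[cite: deShalit1987, II Thm. 4.14 (p. 71), II.4.12 Remark (iv) (p. 67), II.1.1 (p. 32)] -/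
theorem μ_eq_of_forall_identity_imaginaryQuadratic (hK : IsImaginaryQuadratic K)
    (hh : NumberField.classNumber K = 1) (ι : PadicAlgCl 2 ≃+* ℂ) {v vbar : HeightOneSpectrum (𝓞 K)}
    (hv : ((2 : ℕ) : 𝓞 K) ∈ v.asIdeal) (hvbar : ((2 : ℕ) : 𝓞 K) ∈ vbar.asIdeal) (hne : vbar ≠ v)
    (hι : ∀ (w : InfinitePlace K) (k : 𝓞 K), k ∈ v.asIdeal ↔ ‖ι.symm (w.embedding (k : K))‖ < 1)
    {S : Finset (HeightOneSpectrum (𝓞 K))} (hvS : v ∉ S)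
    {𝒰 : SubgroupTower (absoluteGaloisGroup K)} (hopen : ∀ n, IsOpen (𝒰.U n : Set (absoluteGaloisGroup K)))
    (hray : ⋂ n, (𝒰.U n : Set (absoluteGaloisGroup K)) ⊆ DeShalit1987.rayKer K 2 S)
    (hray' : ∀ n, DeShalit1987.rayKer K 2 S ≤ 𝒰.U n) {m₀ : ℕ} (hm₀ : 1 ≤ m₀)
    (μ μ' : GroupDistribution 𝒰 ℂ_[2])
    (R : (ε : HeckeCharacter K) → ℕ → LFunction.HasEntireContinuation (heckeLFunction ε) → ℂ_[2])
    (hμ : ∀ (ε : HeckeCharacter K) (e : FramedGaloisRep K (PadicAlgCl 2) 1) (m : ℕ),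
      IsPAdicAvatarOutside S ι ε e → m₀ ≤ m →
      ε.HasInfinityType (fun _ ↦ -(m : ℤ)) (fun _ ↦ ((0 : ℕ) : ℤ)) →
      (∀ w : HeightOneSpectrum (𝓞 K), w ∉ S → w ≠ vbar → ε.IsUnramifiedAt w) →
      𝒰.IsTowerContinuous (fun σ ↦ avatarValueAt e σ) →
      ∀ hL : LFunction.HasEntireContinuation (heckeLFunction ε),
        μ.integral (fun σ ↦ avatarValueAt e σ) = R ε m hL)
    (hμ' : ∀ (ε : HeckeCharacter K) (e : FramedGaloisRep K (PadicAlgCl 2) 1) (m : ℕ),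
      IsPAdicAvatarOutside S ι ε e → m₀ ≤ m →
      ε.HasInfinityType (fun _ ↦ -(m : ℤ)) (fun _ ↦ ((0 : ℕ) : ℤ)) →
      (∀ w : HeightOneSpectrum (𝓞 K), w ∉ S → w ≠ vbar → ε.IsUnramifiedAt w) →
      𝒰.IsTowerContinuous (fun σ ↦ avatarValueAt e σ) →
      ∀ hL : LFunction.HasEntireContinuation (heckeLFunction ε),
        μ'.integral (fun σ ↦ avatarValueAt e σ) = R ε m hL)
    (N : ℕ) (a : absoluteGaloisGroup K ⧸ 𝒰.U N) : μ.μ N a = μ'.μ N a := by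
  haveI : IsTotallyComplex K := hK.2
  haveI : IsPrincipalIdealRing (𝓞 K) := NumberField.classNumber_eq_one_iff.mp hh
  haveI : v.asIdeal.LiesOver (ratPlace 2).asIdeal := liesOver_ratPlace_of_natCast_mem K v hv
  obtain ⟨he, hf⟩ := ramificationIdx_eq_one_and_inertiaDeg_eq_one_of_natCast_mem_of_ne K hK.1 hv hvbar hne
  obtain ⟨w₀⟩ : Nonempty (InfinitePlace K) := inferInstance
  have hcard : Fintype.card (InfinitePlace K) ≤ 1 := by
    have h1 := NumberField.IsTotallyComplex.finrank K
    have h2 := NumberField.InfinitePlace.card_eq_nrRealPlaces_add_nrComplexPlaces (K := K)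
    rw [NumberField.IsTotallyComplex.nrRealPlaces_eq_zero K, zero_add] at h2
    rw [hK.1] at h1
    omega
  have hw₀ : ∀ w : InfinitePlace K, w = w₀ := fun w ↦ Fintype.card_le_one_iff.1 hcard w w₀
  exact μ_eq_of_forall_identity_lane ι (padicIntEquivOfSplit K hK.1 hvbar hv hne.symm) hvbar hvS hne
    (DeShalit1987.span_natCast_eq_mul_of_finrank_eq_two 2 hK.1 Nat.prime_two hv hvbar hne).symm.le he hf hv
    hw₀ (hι w₀) hopen hray hray' hm₀ μ μ' R hμ hμ' N a

end ImaginaryQuadratic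

end Summit.BirchSwinnertonDyer.BirchSwinnertonDyer.Theorems.PrintCf2.KatzJZeroUnique
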